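import Summits.PneNP.PneNP.Theses.MonochromaticLines

/-!
# Route MonochromaticLines — `MonoLineQueryLowerBound` (stmt-PneNP-11761)

Black-box calibration: for `n ≥ 10`, every deterministic adaptive strategy making `d < 2^{⌊n/10⌋}` colour queries is
fooled by some colouring — its output triple is not a monochromatic combinatorial line. Adversary (simpler than the
one sketched in the route file): answer the `i`-th DISTINCT queried point with the `i`-th colour (binary digits of
`i`; injective because fewer than `2^{⌊n/10⌋}` points are queried); after the run, colour the unqueried points so that
the output triple `(x, y, z)` is not monochromatic: if `y` was queried, every unqueried point gets the one colour never
used as an answer; otherwise `y` gets that fresh colour and every other unqueried point the colour `0`. Two of three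
pairwise-distinct points then always receive different colours.
-/

set_option linter.dupNamespace false -- `Summit.PneNP.PneNP.…`: summit = sub-problem name (D-0017 single-conjunct layout)

namespace Summit.PneNP.PneNP.Theorems

/-- On a prefix, first-occurrence indices agree. [folklore] -/
theorem monochromaticLines_idxOf_of_prefix {l₁ l₂ : List ℕ} (h : l₁ <+: l₂) {a : ℕ} (ha : a ∈ l₁) :
    l₁.idxOf a = l₂.idxOf a := by
  obtain ⟨t, rfl⟩ := h
  exact (List.idxOf_append_of_mem ha).symm

/-- **Support item `MonoLineQueryLowerBound` of route MonochromaticLines (stmt-PneNP-11761)**: `d < 2^{⌊n/10⌋}` adaptive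
colour queries do not suffice to output a monochromatic line, against the fresh-colours adversary.
[cite: KomargodskiNaorYogev2019, §1 (black-box model)] [folklore] -/
theorem monochromaticLines_monoLineQueryLowerBound_proof :
    Summit.PneNP.PneNP.Theses.MonochromaticLines.MonoLineQueryLowerBound := by
  intro n hn d hd q out
  -- colours (`m = ⌊n/10⌋ ≥ 1` of them in each coordinate) and the simulated run
  have hm1 : 1 ≤ n / 10 := by omega
  let colOf : ℕ → (Fin (n / 10) → Bool) := fun j b => Nat.testBit j b
  -- binary colour codes are injective below `2^{⌊n/10⌋}`
  have colOf_inj : ∀ {j j' : ℕ}, j < 2 ^ (n / 10) → j' < 2 ^ (n / 10) → colOf j = colOf j' → j = j' := by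
    intro j j' hj hj' h
    refine Nat.eq_of_testBit_eq fun i => ?_
    by_cases hi : i < n / 10
    · exact congrFun h ⟨i, hi⟩
    · have h2 : 2 ^ (n / 10) ≤ 2 ^ i := Nat.pow_le_pow_right two_pos (by omega)
      rw [Nat.testBit_eq_false_of_lt (lt_of_lt_of_le hj h2), Nat.testBit_eq_false_of_lt (lt_of_lt_of_le hj' h2)]
  let step : List (Fin (n / 10) → Bool) × List ℕ → List (Fin (n / 10) → Bool) × List ℕ := fun s =>
    (s.1 ++ [colOf ((if q s.1 ∈ s.2 then s.2 else s.2 ++ [q s.1]).idxOf (q s.1))],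
      if q s.1 ∈ s.2 then s.2 else s.2 ++ [q s.1])
  let T : ℕ → List (Fin (n / 10) → Bool) × List ℕ := fun i => step^[i] ([], [])
  have hT : ∀ i, T (i + 1) = step (T i) := fun i => Function.iterate_succ_apply' step i _
  -- the list of queried points grows as a prefix chain, by at most one point per query, and contains each query
  have hmemT : ∀ i, q (T i).1 ∈ (T (i + 1)).2 := by
    intro i
    rw [hT]
    simp only [step]
    split_ifs with h
    · exact h
    · exact List.mem_append_right _ (List.mem_singleton_self _)
  have hprefix1 : ∀ i, (T i).2 <+: (T (i + 1)).2 := by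
    intro i
    rw [hT]
    simp only [step]
    split_ifs
    · exact List.prefix_rfl
    · exact List.prefix_append _ _
  have hprefix : ∀ i j, i ≤ j → (T i).2 <+: (T j).2 := by
    intro i j hij
    induction hij with
    | refl => exact List.prefix_rfl
    | step _ ih => exact ih.trans (hprefix1 _)
  have hlen : ∀ i, ((T i).2).length ≤ i := by
    intro i
    induction i with
    | zero => simp [T]
    | succ i ih =>
      rw [hT]
      simp only [step]
      split_ifs
      · omega
      · rw [List.length_append, List.length_singleton]; omega
  -- the adversary's colouring
  set M := (T d).2 with hM
  set s := out (T d).1 with hs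
  set F : Fin (n / 10) → Bool := colOf (2 ^ (n / 10) - 1) with hF
  let c : ℕ → (Fin (n / 10) → Bool) := fun p =>
    if p ∈ M then colOf (M.idxOf p) else if p = s.2.1 ∨ s.2.1 ∈ M then F else colOf 0
  have hcM : ∀ p ∈ M, c p = colOf (M.idxOf p) := fun p hp => by simp only [c, hp, if_true]
  -- the real run coincides with the simulated one
  have hrun : ∀ i, i ≤ d →
      (Nat.rec (motive := fun _ => List (Fin (n / 10) → Bool)) [] (fun _ acc => acc ++ [c (q acc)]) i) = (T i).1 := by
    intro i
    induction i with
    | zero => intro; rfl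
    | succ i ih =>
      intro hi
      have ih' := ih (by omega)
      show (Nat.rec (motive := fun _ => List (Fin (n / 10) → Bool)) [] (fun _ acc => acc ++ [c (q acc)]) i) ++
          [c (q (Nat.rec (motive := fun _ => List (Fin (n / 10) → Bool)) [] (fun _ acc => acc ++ [c (q acc)]) i))] = _
      rw [ih']
      have hpM1 : q (T i).1 ∈ (T (i + 1)).2 := hmemT i
      have hpM : q (T i).1 ∈ M := (hprefix (i + 1) d (by omega)).subset hpM1
      rw [hcM _ hpM, ← monochromaticLines_idxOf_of_prefix (hprefix (i + 1) d (by omega)) hpM1, hT]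
  refine ⟨c, ?_⟩
  beta_reduce
  rw [hrun d le_rfl]
  change ¬ ((s.1 < 3 ^ n ∧ s.2.1 < 3 ^ n ∧ s.2.2 < 3 ^ n ∧ s.1 ≠ s.2.1 ∧ s.2.1 ≠ s.2.2 ∧ s.1 ≠ s.2.2 ∧
      ∀ l : ℕ, l < n → (s.1 / 3 ^ l % 3 + s.2.1 / 3 ^ l % 3 + s.2.2 / 3 ^ l % 3) % 3 = 0) ∧
    c s.1 = c s.2.1 ∧ c s.2.1 = c s.2.2)
  rintro ⟨⟨-, -, -, hxy, hyz, hxz, -⟩, h12, h23⟩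
  -- facts about the colours in play
  have h2m : 2 ≤ 2 ^ (n / 10) := by
    calc 2 = 2 ^ 1 := by norm_num
      _ ≤ 2 ^ (n / 10) := Nat.pow_le_pow_right two_pos hm1
  have hMlen : M.length ≤ d := hlen d
  have hidx_lt : ∀ p ∈ M, M.idxOf p < 2 ^ (n / 10) - 1 := fun p hp => by
    have := List.idxOf_lt_length_iff.2 hp
    omega
  have hqF : ∀ p ∈ M, colOf (M.idxOf p) ≠ F := fun p hp hEq =>
    absurd (colOf_inj (by have := hidx_lt p hp; omega) (by omega) hEq) (hidx_lt p hp).ne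
  have h0F : colOf 0 ≠ F := fun hEq =>
    absurd (colOf_inj (by omega) (by omega) hEq) (by omega)
  have hqq : ∀ p ∈ M, ∀ p' ∈ M, colOf (M.idxOf p) = colOf (M.idxOf p') → p = p' := fun p hp p' hp' hEq =>
    (List.idxOf_inj hp).1 (colOf_inj (by have := hidx_lt p hp; omega)
      (by have := hidx_lt p' hp'; omega) hEq)
  -- case analysis on which of `x = s.1`, `y = s.2.1` were queried
  by_cases hy : s.2.1 ∈ M
  · rw [hcM _ hy] at h12
    by_cases hx : s.1 ∈ M
    · rw [hcM _ hx] at h12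
      exact hxy (hqq _ hx _ hy h12)
    · have hcx : c s.1 = F := by simp only [c, hx, if_false, hy, or_true, if_true]
      rw [hcx] at h12
      exact hqF _ hy h12.symm
  · have hcy : c s.2.1 = F := by simp only [c, hy, if_false, true_or, if_true]
    rw [hcy] at h12
    by_cases hx : s.1 ∈ M
    · rw [hcM _ hx] at h12
      exact hqF _ hx h12
    · have hcx : c s.1 = colOf 0 := by simp only [c, hx, if_false, hxy, hy, or_self, if_false]
      rw [hcx] at h12
      exact h0F h12

end Summit.PneNP.PneNP.Theorems
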